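import Summits.BirchSwinnertonDyer.Rank1Residual.X11b.BDPRouteRTDegreeTelescope
import Summits.BirchSwinnertonDyer.Rank1Residual.X11b.BDPRouteRTDegreeCokerUnits
import HarnessLib

/-!
# Route `ErratumRoadFive` (K2, `p ≥ 5`), crux `EulerHalfNotRamNoInertSetAtFive` (item stmt-BirchSwinnertonDyer-19715), line `birth`:
# THE `p`-ANCHOR, §1 of 4 — over the abstract Ribet–Takahashi ∕ Pasten degree package, every cokernel term of an even level containing the residual
# prime `ℓ` is an `ℓ`-adic unit, hence the (DEG) telescope `ord_ℓ δ(∅) = ord_ℓ δ(S) + Σ_{q∈S} ord_ℓ c_q` holds for EVERY even `S ∋ ℓ`, witness-free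
# (cell `bsd-stepL`, lead seat `bsd-line-er5-p1` g1; `--supports stmt-BirchSwinnertonDyer-19715 --as helper`)

WHAT. Three lemmas over the tree's abstract package `Summit.BirchSwinnertonDyer.Rank1Residual.X11b.RTDegree` (section variables (P613) Pasten Prop. 6.13
both expressions, positivity, (Pij), the valuation forms (P68)@ℓ ∕ (PEis)@ℓ) + the package's (P618) clause (Pasten Lemma 6.18 = Papikian–Rabinoff Cor. 3.5:
at an odd prime `q` OF THE LEVEL `D` the cokernel `κ_D(q)` divides `q − 1`) + `ℓ ≠ 2`:
* `padicValNat_coker_self_eq_zero` — (P618) at `q = ℓ ∈ D`: `ℓ ∤ κ_D(ℓ)` (`κ_D(ℓ) ∣ ℓ − 1`);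
* `padicValNat_coker_eq_zero_of_self_mem` — for `ℓ ∈ D` EVERY `κ_D(q)`, `q ∈ D`, is an `ℓ`-unit (the tree's switching lemma
  `RTDegree.padicValNat_coker_eq_of_pair` against `ℓ`);
* `padicValNat_delta_empty_eq_of_self_mem` — (DEG) for every even `S ∋ ℓ` by the `ℓ`-last telescope (`RTDegree.padicValNat_delta_empty_step`).
So on the INERT frames of the record (`p ∈ S`) the degree datum «(W) witness ∨ (P) Papikian–Rabinoff half» is never needed: the BSD prime anchors it.

Credit: the `p`-anchor is the critic idea-crit-14's (VERDICT #29, scratch `ResidualMem.lean` 1c5fc830ef431d01) and the ideator bsd-idea-9 g4's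
(crux workfile `Cruxes/EulerHalfNotRamNoInertSetAtFive/Lines/coker_units_surj.lean` v4, sha16 ea858e0da1dbc78d, farm rc 0 · 0 sorries, re-checked by the LEAD
from its own folder); crux workfiles are not importable, so the LEAD moves the text to `Theorems/` VERBATIM (statements and proofs unchanged; namespace
`Theorems.EulerHalfPAnchor`). HONEST FRAMING: THEOREMS ONLY, CONDITIONAL on their displayed hypotheses (route items by name, the typed saved display ∕ LAB =
HOLE 1, printed named facts); no `sorry`, no definition, no new named fact; nothing booked; item 19715 is NOT closed; BSD is proved for no curve; no summit
statement is touched.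
[cite: PastenShimura2024, Prop. 6.13, Lemma 6.15, Lemma 6.18] [cite: PapikianRabinoff2016, Cor. 3.5] [cite: RibetTakahashi1997, Thm. 1]
-/

set_option autoImplicit false
set_option linter.dupNamespace false

noncomputable section

open scoped Classical

open Summit.BirchSwinnertonDyer.Rank1Residual.X11b

namespace Summit.BirchSwinnertonDyer.BirchSwinnertonDyer.Theorems.EulerHalfPAnchor

/-! ### The `p`-anchor over the abstract degree package -/

namespace PAnchor

variable {ℓ : ℕ} [Fact ℓ.Prime]
variable {Mult : Finset ℕ} {δ : Finset ℕ → ℕ} {cA ι κ : Finset ℕ → ℕ → ℕ} {c : ℕ → ℕ}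
  -- (P613) Pasten Prop. 6.13 (both expressions)
  (h613 : ∀ ⦃d : Finset ℕ⦄, d ⊆ Mult → Even d.card → ∀ ⦃q r : ℕ⦄, q ∈ Mult → r ∈ Mult →
    q ∉ d → r ∉ d → q ≠ r →
    δ d * ι d q ^ 2 * κ (insert q (insert r d)) r ^ 2 =
      δ (insert q (insert r d)) * cA d q * cA (insert q (insert r d)) r)
  (hδ : ∀ D, 0 < δ D) (hcA : ∀ D q, 0 < cA D q)
  (hij : ∀ ⦃D : Finset ℕ⦄, D ⊆ Mult → ∀ ⦃q : ℕ⦄, q ∈ Mult → ι D q * κ D q = cA D q)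
  (hvA : ∀ ⦃D : Finset ℕ⦄, D ⊆ Mult → ∀ ⦃q : ℕ⦄, q ∈ Mult →
    padicValNat ℓ (cA D q) = padicValNat ℓ (c q))
  (hι : ∀ ⦃d : Finset ℕ⦄, d ⊆ Mult → ∀ ⦃q : ℕ⦄, q ∈ Mult → q ∉ d → padicValNat ℓ (ι d q) = 0)
  -- (P618) Pasten Lemma 6.18 (Papikian–Rabinoff Cor. 3.5): at an odd prime OF THE LEVEL the cokernel divides `q − 1`
  (h618 : ∀ ⦃D : Finset ℕ⦄, D ⊆ Mult → Even D.card → ∀ ⦃q : ℕ⦄, q ∈ D → q ≠ 2 → κ D q ∣ q - 1)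
  (hℓ2 : ℓ ≠ 2)

include h613 hδ hcA hij hvA hι h618 hℓ2

omit h613 hδ hcA hij hvA hι in
/-- **(P618) at the residual prime:** `ℓ ∤ j_ℓ(D)` for every even level `D ∋ ℓ` (`j_ℓ ∣ ℓ − 1`). (idea-crit-14, V29.) [cite: PastenShimura2024, Lemma 6.18] -/
theorem padicValNat_coker_self_eq_zero {D : Finset ℕ} (hD : D ⊆ Mult) (hDe : Even D.card) (hℓD : ℓ ∈ D) :
    padicValNat ℓ (κ D ℓ) = 0 := by
  have hℓp : ℓ.Prime := Fact.out
  have hdvd : κ D ℓ ∣ ℓ - 1 := h618 hD hDe hℓD hℓ2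
  refine padicValNat.eq_zero_of_not_dvd fun h ↦ ?_
  have h1 : ℓ ∣ ℓ - 1 := h.trans hdvd
  have h2 : 0 < ℓ - 1 := by have := hℓp.two_le; omega
  have h3 := Nat.le_of_dvd h2 h1
  omega

/-- **Every cokernel term of an even level containing the residual prime is an `ℓ`-adic unit** (L6.15 switching against `ℓ` + L6.18 at `ℓ`).
(idea-crit-14, V29.) [cite: PastenShimura2024, Prop. 6.13, Lemma 6.15, Lemma 6.18] -/
theorem padicValNat_coker_eq_zero_of_self_mem {D : Finset ℕ} (hD : D ⊆ Mult) (hDe : Even D.card) (hℓD : ℓ ∈ D)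
    {q : ℕ} (hq : q ∈ D) : padicValNat ℓ (κ D q) = 0 := by
  have hself := padicValNat_coker_self_eq_zero h618 hℓ2 hD hDe hℓD
  by_cases hqℓ : q = ℓ
  · subst hqℓ; exact hself
  · set d := (D.erase q).erase ℓ with hd_def
    have hdD : d ⊆ D := (Finset.erase_subset _ _).trans (Finset.erase_subset _ _)
    have hd : d ⊆ Mult := hdD.trans hD
    have hqd : q ∉ d := fun h ↦ (Finset.notMem_erase q D) ((Finset.erase_subset ℓ _) h)
    have hℓd : ℓ ∉ d := Finset.notMem_erase ℓ _
    have hℓ' : ℓ ∈ D.erase q := Finset.mem_erase.mpr ⟨Ne.symm hqℓ, hℓD⟩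
    have hDeq : insert q (insert ℓ d) = D := by
      rw [hd_def, Finset.insert_erase hℓ', Finset.insert_erase hq]
    have hcard : D.card = d.card + 2 := by
      have h1 := Finset.card_erase_of_mem hq
      have h2 := Finset.card_erase_of_mem hℓ'
      have h3 : 0 < D.card := Finset.card_pos.mpr ⟨q, hq⟩
      have h4 : 0 < (D.erase q).card := Finset.card_pos.mpr ⟨ℓ, hℓ'⟩
      rw [hd_def]; omega
    have hde : Even d.card := by
      rw [hcard] at hDe
      exact (Nat.even_add.mp hDe).mpr (by decide)
    have h := RTDegree.padicValNat_coker_eq_of_pair h613 hδ hcA hij hvA hι hd hde (hD hq) (hD hℓD) hqd hℓd hqℓ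
    rw [hDeq] at h
    omega

/-- **(DEG) for every even `S ∋ ℓ`, witness-free:** `ord_ℓ δ(∅) = ord_ℓ δ(S) + Σ_{q∈S} ord_ℓ c_q(E)` (the `ℓ`-last telescope). (idea-crit-14, V29.)
[cite: PastenShimura2024, Prop. 6.13, §6.6] [cite: RibetTakahashi1997, Thm. 1] -/
theorem padicValNat_delta_empty_eq_of_self_mem :
    ∀ (n : ℕ) (S : Finset ℕ), S ⊆ Mult → S.card = 2 * n → (S = ∅ ∨ ℓ ∈ S) →
      padicValNat ℓ (δ ∅) = padicValNat ℓ (δ S) + ∑ x ∈ S, padicValNat ℓ (c x) := by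
  intro n
  induction n with
  | zero =>
    intro S _ hS _
    rw [Finset.card_eq_zero.mp (by omega : S.card = 0)]
    simp
  | succ n IH =>
    intro S hS hcard hℓ₀
    have hℓS : ℓ ∈ S := by
      rcases hℓ₀ with h | h
      · subst h; simp at hcard
      · exact h
    have hSe : Even S.card := ⟨n + 1, by omega⟩
    have hκS : ∀ x ∈ S, padicValNat ℓ (κ S x) = 0 := fun x hx ↦
      padicValNat_coker_eq_zero_of_self_mem h613 hδ hcA hij hvA hι h618 hℓ2 hS hSe hℓS hx
    have hne : (S.erase ℓ).Nonempty := by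
      apply Finset.card_pos.mp; rw [Finset.card_erase_of_mem hℓS]; omega
    obtain ⟨r, hr⟩ := hne
    obtain ⟨hrℓ, hrS⟩ := Finset.mem_erase.mp hr
    have hq : ∃ q ∈ S, q ≠ r ∧ (n = 0 ∨ q ≠ ℓ) := by
      by_cases hn : n = 0
      · exact ⟨ℓ, hℓS, Ne.symm hrℓ, Or.inl hn⟩
      · have hne' : ((S.erase ℓ).erase r).Nonempty := by
          apply Finset.card_pos.mp
          rw [Finset.card_erase_of_mem hr, Finset.card_erase_of_mem hℓS]; omega
        obtain ⟨q, hq⟩ := hne'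
        obtain ⟨hqr, hq'⟩ := Finset.mem_erase.mp hq
        obtain ⟨hqℓ, hqS⟩ := Finset.mem_erase.mp hq'
        exact ⟨q, hqS, hqr, Or.inr hqℓ⟩
    obtain ⟨q, hqS, hqr, hqn⟩ := hq
    set d := (S.erase q).erase r with hd_def
    have hrq' : r ∈ S.erase q := Finset.mem_erase.mpr ⟨hqr.symm, hrS⟩
    have hSeq : insert q (insert r d) = S := by
      rw [hd_def, Finset.insert_erase hrq', Finset.insert_erase hqS]
    have hdS : d ⊆ S := (Finset.erase_subset _ _).trans (Finset.erase_subset _ _)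
    have hd : d ⊆ Mult := hdS.trans hS
    have hqd : q ∉ d := fun h ↦ (Finset.notMem_erase q S) ((Finset.erase_subset r _) h)
    have hrd : r ∉ d := Finset.notMem_erase r _
    have hdcard : d.card = 2 * n := by
      have h1 := Finset.card_erase_of_mem hqS
      have h2 := Finset.card_erase_of_mem hrq'
      rw [hd_def]; omega
    have hde : Even d.card := ⟨n, by omega⟩
    have hdℓ : d = ∅ ∨ ℓ ∈ d := by
      rcases hqn with hn | hqℓ
      · left; subst hn; exact Finset.card_eq_zero.mp (by omega)
      · right
        exact Finset.mem_erase.mpr ⟨Ne.symm hrℓ, Finset.mem_erase.mpr ⟨Ne.symm hqℓ, hℓS⟩⟩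
    have IH' := IH d hd hdcard hdℓ
    have hκ : padicValNat ℓ (κ (insert q (insert r d)) r) = 0 := by
      rw [hSeq]; exact hκS r hrS
    have := RTDegree.padicValNat_delta_empty_step h613 hδ hcA hij hvA hι hd hde (hS hqS) (hS hrS) hqd hrd hqr
      hκ IH'
    rwa [hSeq] at this

end PAnchor

end Summit.BirchSwinnertonDyer.BirchSwinnertonDyer.Theorems.EulerHalfPAnchor

end
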